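import Mathlib
import Summits.ValiantsHypothesis.ValiantsHypothesis.Theorems.ElementaryWordLengthWordLengthQPStubKappaTwoStructureAux
import Summits.ValiantsHypothesis.ValiantsHypothesis.Theorems.ElementaryWordLengthWordLengthQPStubKappaTwoStructureAuxB
import Summits.ValiantsHypothesis.ValiantsHypothesis.Theorems.ElementaryWordLengthWordLengthQPStubKappaTwoStructureAuxC
import Summits.ValiantsHypothesis.ValiantsHypothesis.Theorems.ElementaryWordLengthWordLengthQPStubKappaTwoStructureAuxD
import Summits.ValiantsHypothesis.ValiantsHypothesis.Theorems.ElementaryWordLengthWordLengthQPStubKappaTwoStructureAuxE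
import Summits.ValiantsHypothesis.ValiantsHypothesis.Theorems.ElementaryWordLengthWordLengthQPStubKappaTwoStructureAuxF
import Summits.ValiantsHypothesis.ValiantsHypothesis.Theorems.ElementaryWordLengthWordLengthQPStubKappaTwoStructureAuxG

/-!
# Crux `WordLengthQP` (stmt-ValiantsHypothesis-6623), line `positive-monoid-exits` —
helpers for stub `stub_kappaTwoStructure`, part H: the `(y₁, x₁)` family is impossible.

`k2_family_I`: no word `P₀ ℓ₁ Q ℓ₂ P₂` with tame `P₀, Q, P₂`, `ℓ₁` of type `(1,0)` and `ℓ₂` of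
type `(0,1)` (any coefficients) computes `E₀₂(F)` with `F ≠ 0` all of whose monomials have
degree `≥ 3` (degree `≥ 2` would suffice).  Proof: skeleton loop ⇒ confinement (`k2_conf_I`) ⇒
the stretches' skeleton letters are `TNB` ⇒ KEY (`k2_key_I`): `(P̄₂ Ḡ)₁₁ ≥ 1` for every prefix ⇒
the kill lemma with the test `X ↦ (P̄₂ X)₁₂` annihilates every variable `x₂`-letter ⇒ no letter
feeds column `2` ⇒ `F = 0`.
-/

set_option linter.dupNamespace false

noncomputable section

namespace Summit.ValiantsHypothesis.ValiantsHypothesis.Cruxes.WordLengthQP.PositiveMonoidExits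

open MvPolynomial

/-- Membership in a two-exit word. [folklore] -/
theorem k2_mem_word {α : Type*} (p0 q p2 : List α) (L1 L2 l : α)
    (h : l ∈ p0 ++ L1 :: (q ++ L2 :: p2)) : l = L1 ∨ l = L2 ∨ l ∈ p0 ++ q ++ p2 := by
  simp only [List.mem_append, List.mem_cons] at h ⊢
  tauto

/-- **Family `(y₁, x₁)` is impossible.** See the module docstring. [folklore] -/
theorem k2_family_I {σ : Type} (F : MvPolynomial σ ℝ)
    (hdeg : ∀ m ∈ F.support, 3 ≤ Finsupp.degree m) (hF0 : F ≠ 0)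
    (p0 q p2 : List (Fin 3 × Fin 3 × ℝ × Option σ)) (L1 L2 : Fin 3 × Fin 3 × ℝ × Option σ)
    (hw : ∀ l ∈ p0 ++ L1 :: (q ++ L2 :: p2), l.1 ≠ l.2.1)
    (ht : ∀ l ∈ p0 ++ q ++ p2, ((0 < Prod.fst (Prod.snd (Prod.snd l)) ∧ (Fin.val (Prod.fst l) + 1 = Fin.val (Prod.fst (Prod.snd l)) ∨ Fin.val (Prod.fst (Prod.snd l)) + 1 = Fin.val (Prod.fst l))) ∨ Prod.fst (Prod.snd (Prod.snd l)) = 0))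
    (hL1 : L1.1 = 1 ∧ L1.2.1 = 0) (hL2 : L2.1 = 0 ∧ L2.2.1 = 1)
    (hF : ((p0 ++ L1 :: (q ++ L2 :: p2)).map (fun l => (Matrix.transvection (Prod.fst l) (Prod.fst (Prod.snd l)) (MvPolynomial.C (Prod.fst (Prod.snd (Prod.snd l))) * Option.elim (Prod.snd (Prod.snd (Prod.snd l))) 1 MvPolynomial.X) : Matrix (Fin 3) (Fin 3) (MvPolynomial σ ℝ)))).prod =
      Matrix.transvection (0 : Fin 3) 2 F) : False := by
  classical
  set w := p0 ++ L1 :: (q ++ L2 :: p2) with hwdef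
  have hdeg1 : ∀ m ∈ F.support, 1 ≤ Finsupp.degree m := fun m hm => le_trans (by norm_num) (hdeg m hm)
  have hdeg2 : ∀ m ∈ F.support, 2 ≤ Finsupp.degree m := fun m hm => le_trans (by norm_num) (hdeg m hm)
  -- skeleton letters of the two exits
  set a : ℝ := L1.2.2.2.elim L1.2.2.1 (fun _ => 0) with ha
  set b : ℝ := L2.2.2.2.elim L2.2.2.1 (fun _ => 0) with hb
  have hcL1 : (Matrix.transvection (Prod.fst L1) (Prod.fst (Prod.snd L1)) (Option.elim (Prod.snd (Prod.snd (Prod.snd L1))) (Prod.fst (Prod.snd (Prod.snd L1))) (fun _ => (0 : ℝ))) : Matrix (Fin 3) (Fin 3) ℝ) = Matrix.transvection 1 0 a := by rw [hL1.1, hL1.2]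
  have hcL2 : (Matrix.transvection (Prod.fst L2) (Prod.fst (Prod.snd L2)) (Option.elim (Prod.snd (Prod.snd (Prod.snd L2))) (Prod.fst (Prod.snd (Prod.snd L2))) (fun _ => (0 : ℝ))) : Matrix (Fin 3) (Fin 3) ℝ) = Matrix.transvection 0 1 b := by rw [hL2.1, hL2.2]
  set P2 : Matrix (Fin 3) (Fin 3) ℝ := (p2.map (fun l => (Matrix.transvection (Prod.fst l) (Prod.fst (Prod.snd l)) (Option.elim (Prod.snd (Prod.snd (Prod.snd l))) (Prod.fst (Prod.snd (Prod.snd l))) (fun _ => (0 : ℝ))) : Matrix (Fin 3) (Fin 3) ℝ))).prod with hP2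
  -- the skeleton loop
  have hsk := k2_skel_loop F hdeg1 w hF
  have hloop : (p0.map (fun l => (Matrix.transvection (Prod.fst l) (Prod.fst (Prod.snd l)) (Option.elim (Prod.snd (Prod.snd (Prod.snd l))) (Prod.fst (Prod.snd (Prod.snd l))) (fun _ => (0 : ℝ))) : Matrix (Fin 3) (Fin 3) ℝ))).prod * (Matrix.transvection 1 0 a *
      ((q.map (fun l => (Matrix.transvection (Prod.fst l) (Prod.fst (Prod.snd l)) (Option.elim (Prod.snd (Prod.snd (Prod.snd l))) (Prod.fst (Prod.snd (Prod.snd l))) (fun _ => (0 : ℝ))) : Matrix (Fin 3) (Fin 3) ℝ))).prod * (Matrix.transvection 0 1 b * P2))) = 1 := by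
    simpa only [hwdef, List.map_append, List.map_cons, List.prod_append, List.prod_cons, hcL1, hcL2]
      using hsk
  -- confinement, TNB of the stretches, BLK of everything
  have conf := k2_conf_I p0 q p2 a b ht hloop
  have tnb : ∀ G ∈ p0.map (fun l => (Matrix.transvection (Prod.fst l) (Prod.fst (Prod.snd l)) (Option.elim (Prod.snd (Prod.snd (Prod.snd l))) (Prod.fst (Prod.snd (Prod.snd l))) (fun _ => (0 : ℝ))) : Matrix (Fin 3) (Fin 3) ℝ)) ++ q.map (fun l => (Matrix.transvection (Prod.fst l) (Prod.fst (Prod.snd l)) (Option.elim (Prod.snd (Prod.snd (Prod.snd l))) (Prod.fst (Prod.snd (Prod.snd l))) (fun _ => (0 : ℝ))) : Matrix (Fin 3) (Fin 3) ℝ)) ++ p2.map (fun l => (Matrix.transvection (Prod.fst l) (Prod.fst (Prod.snd l)) (Option.elim (Prod.snd (Prod.snd (Prod.snd l))) (Prod.fst (Prod.snd (Prod.snd l))) (fun _ => (0 : ℝ))) : Matrix (Fin 3) (Fin 3) ℝ)),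
      G 0 2 = 0 ∧ G 1 2 = 0 ∧ G 2 0 = 0 ∧ G 2 1 = 0 ∧ G 2 2 = 1 ∧ 0 ≤ G 0 1 ∧ 0 ≤ G 1 0 ∧
        1 ≤ G 0 0 ∧ 1 ≤ G 1 1 ∧ G 0 0 * G 1 1 - G 0 1 * G 1 0 = 1 := by
    intro G hG
    rw [← List.map_append, ← List.map_append] at hG
    obtain ⟨l, hl, rfl⟩ := List.mem_map.1 hG
    exact k2_tnb_skel l (ht l hl) (fun ho => (conf l hl ho).1) (fun ho => (conf l hl ho).2)
  have blk : ∀ l ∈ w, (Matrix.transvection (Prod.fst l) (Prod.fst (Prod.snd l)) (Option.elim (Prod.snd (Prod.snd (Prod.snd l))) (Prod.fst (Prod.snd (Prod.snd l))) (fun _ => (0 : ℝ))) : Matrix (Fin 3) (Fin 3) ℝ) 0 2 = 0 ∧ (Matrix.transvection (Prod.fst l) (Prod.fst (Prod.snd l)) (Option.elim (Prod.snd (Prod.snd (Prod.snd l))) (Prod.fst (Prod.snd (Prod.snd l))) (fun _ => (0 : ℝ))) : Matrix (Fin 3) (Fin 3) ℝ) 1 2 = 0 ∧ (Matrix.transvection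 (Prod.fst l) (Prod.fst (Prod.snd l)) (Option.elim (Prod.snd (Prod.snd (Prod.snd l))) (Prod.fst (Prod.snd (Prod.snd l))) (fun _ => (0 : ℝ))) : Matrix (Fin 3) (Fin 3) ℝ) 2 0 = 0 ∧ (Matrix.transvection (Prod.fst l) (Prod.fst (Prod.snd l)) (Option.elim (Prod.snd (Prod.snd (Prod.snd l))) (Prod.fst (Prod.snd (Prod.snd l))) (fun _ => (0 : ℝ))) : Matrix (Fin 3) (Fin 3) ℝ) 2 1 = 0 ∧
      (Matrix.transvection (Prod.fst l) (Prod.fst (Prod.snd l)) (Option.elim (Prod.snd (Prod.snd (Prod.snd l))) (Prod.fst (Prod.snd (Prod.snd l))) (fun _ => (0 : ℝ))) : Matrix (Fin 3) (Fin 3) ℝ) 2 2 = 1 := by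
    intro l hl
    rcases k2_mem_word p0 q p2 L1 L2 l hl with rfl | rfl | hl'
    · rw [hcL1]; exact (k2_blk_letter a).2
    · rw [hcL2]; exact (k2_blk_letter b).1
    · have t := k2_tnb_skel l (ht l hl') (fun ho => (conf l hl' ho).1) (fun ho => (conf l hl' ho).2)
      exact ⟨t.1, t.2.1, t.2.2.1, t.2.2.2.1, t.2.2.2.2.1⟩
  have sufblk : ∀ (A : List _) (l : Fin 3 × Fin 3 × ℝ × Option σ) (B : List _), w = A ++ l :: B →
      (B.map (fun l => (Matrix.transvection (Prod.fst l) (Prod.fst (Prod.snd l)) (Option.elim (Prod.snd (Prod.snd (Prod.snd l))) (Prod.fst (Prod.snd (Prod.snd l))) (fun _ => (0 : ℝ))) : Matrix (Fin 3) (Fin 3) ℝ))).prod 0 2 = 0 ∧ (B.map (fun l => (Matrix.transvection (Prod.fst l) (Prod.fst (Prod.snd l)) (Option.elim (Prod.snd (Prod.snd (Prod.snd l))) (Prod.fst (Prod.snd (Prod.snd l))) (fun _ => (0 : ℝ))) : Matrix (Fin 3) (Fin 3) ℝ))).prod 1 2 = 0 ∧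
      (B.map (fun l => (Matrix.transvection (Prod.fst l) (Prod.fst (Prod.snd l)) (Option.elim (Prod.snd (Prod.snd (Prod.snd l))) (Prod.fst (Prod.snd (Prod.snd l))) (fun _ => (0 : ℝ))) : Matrix (Fin 3) (Fin 3) ℝ))).prod 2 0 = 0 ∧ (B.map (fun l => (Matrix.transvection (Prod.fst l) (Prod.fst (Prod.snd l)) (Option.elim (Prod.snd (Prod.snd (Prod.snd l))) (Prod.fst (Prod.snd (Prod.snd l))) (fun _ => (0 : ℝ))) : Matrix (Fin 3) (Fin 3) ℝ))).prod 2 1 = 0 ∧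
      (B.map (fun l => (Matrix.transvection (Prod.fst l) (Prod.fst (Prod.snd l)) (Option.elim (Prod.snd (Prod.snd (Prod.snd l))) (Prod.fst (Prod.snd (Prod.snd l))) (fun _ => (0 : ℝ))) : Matrix (Fin 3) (Fin 3) ℝ))).prod 2 2 = 1 := by
    intro A l B hAB
    refine k2_blk_prod _ fun G hG => ?_
    obtain ⟨l', hl', rfl⟩ := List.mem_map.1 hG
    exact blk l' (by rw [hAB]; simp [hl'])
  -- KEY
  have key := k2_key_I (p0.map (fun l => (Matrix.transvection (Prod.fst l) (Prod.fst (Prod.snd l)) (Option.elim (Prod.snd (Prod.snd (Prod.snd l))) (Prod.fst (Prod.snd (Prod.snd l))) (fun _ => (0 : ℝ))) : Matrix (Fin 3) (Fin 3) ℝ))) (q.map (fun l => (Matrix.transvection (Prod.fst l) (Prod.fst (Prod.snd l)) (Option.elim (Prod.snd (Prod.snd (Prod.snd l))) (Prod.fst (Prod.snd (Prod.snd l))) (fun _ => (0 : ℝ))) : Matrix (Fin 3) (Fin 3) ℝ))) (p2.map (fun l => (Matrix.transvection (Prod.fst l) (Prod.fst (Prod.snd l)) (Option.elim (Prod.snd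 (Prod.snd (Prod.snd l))) (Prod.fst (Prod.snd (Prod.snd l))) (fun _ => (0 : ℝ))) : Matrix (Fin 3) (Fin 3) ℝ)))
    a b tnb hloop
  have pref : ∀ (A : List _) (l : Fin 3 × Fin 3 × ℝ × Option σ) (B : List _), w = A ++ l :: B →
      1 ≤ (P2 * (A.map (fun l => (Matrix.transvection (Prod.fst l) (Prod.fst (Prod.snd l)) (Option.elim (Prod.snd (Prod.snd (Prod.snd l))) (Prod.fst (Prod.snd (Prod.snd l))) (fun _ => (0 : ℝ))) : Matrix (Fin 3) (Fin 3) ℝ))).prod : Matrix (Fin 3) (Fin 3) ℝ) 1 1 := by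
    intro A l B hAB
    rcases k2_decomp5 p0 q p2 A B L1 L2 l hAB with
      ⟨t, hp⟩ | ⟨rfl, rfl⟩ | ⟨s', t, hq', rfl⟩ | ⟨rfl, rfl⟩ | ⟨s', t, hp2', rfl⟩
    · exact key.1 _ ((l :: t).map (fun l => (Matrix.transvection (Prod.fst l) (Prod.fst (Prod.snd l)) (Option.elim (Prod.snd (Prod.snd (Prod.snd l))) (Prod.fst (Prod.snd (Prod.snd l))) (fun _ => (0 : ℝ))) : Matrix (Fin 3) (Fin 3) ℝ))) (by rw [hp, List.map_append])
    · exact key.1 _ [] (by simp)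
    · have := key.2.1 (s'.map (fun l => (Matrix.transvection (Prod.fst l) (Prod.fst (Prod.snd l)) (Option.elim (Prod.snd (Prod.snd (Prod.snd l))) (Prod.fst (Prod.snd (Prod.snd l))) (fun _ => (0 : ℝ))) : Matrix (Fin 3) (Fin 3) ℝ))) ((l :: t).map (fun l => (Matrix.transvection (Prod.fst l) (Prod.fst (Prod.snd l)) (Option.elim (Prod.snd (Prod.snd (Prod.snd l))) (Prod.fst (Prod.snd (Prod.snd l))) (fun _ => (0 : ℝ))) : Matrix (Fin 3) (Fin 3) ℝ)))
        (by rw [hq', List.map_append])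
      simpa only [List.map_append, List.map_cons, List.prod_append, List.prod_cons, hcL1,
        Matrix.mul_assoc] using this
    · have := key.2.1 (q.map (fun l => (Matrix.transvection (Prod.fst l) (Prod.fst (Prod.snd l)) (Option.elim (Prod.snd (Prod.snd (Prod.snd l))) (Prod.fst (Prod.snd (Prod.snd l))) (fun _ => (0 : ℝ))) : Matrix (Fin 3) (Fin 3) ℝ))) [] (by simp)
      simpa only [List.map_append, List.map_cons, List.prod_append, List.prod_cons, hcL1,
        Matrix.mul_assoc, List.append_nil] using this
    · have := key.2.2 (s'.map (fun l => (Matrix.transvection (Prod.fst l) (Prod.fst (Prod.snd l)) (Option.elim (Prod.snd (Prod.snd (Prod.snd l))) (Prod.fst (Prod.snd (Prod.snd l))) (fun _ => (0 : ℝ))) : Matrix (Fin 3) (Fin 3) ℝ))) ((l :: t).map (fun l => (Matrix.transvection (Prod.fst l) (Prod.fst (Prod.snd l)) (Option.elim (Prod.snd (Prod.snd (Prod.snd l))) (Prod.fst (Prod.snd (Prod.snd l))) (fun _ => (0 : ℝ))) : Matrix (Fin 3) (Fin 3) ℝ)))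
        (by rw [hp2', List.map_append])
      simpa only [List.map_append, List.map_cons, List.prod_append, List.prod_cons, hcL1, hcL2,
        Matrix.mul_assoc] using this
  -- letters feeding column 2 are tame letters of the stretches
  have three : ∀ i : Fin 3, i = 0 ∨ i = 1 ∨ i = 2 := by decide
  have col2mem : ∀ l ∈ w, l.2.1 = 2 → ((0 < Prod.fst (Prod.snd (Prod.snd l)) ∧ (Fin.val (Prod.fst l) + 1 = Fin.val (Prod.fst (Prod.snd l)) ∨ Fin.val (Prod.fst (Prod.snd l)) + 1 = Fin.val (Prod.fst l))) ∨ Prod.fst (Prod.snd (Prod.snd l)) = 0) ∧ l ∈ p0 ++ q ++ p2 := by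
    intro l hl hj
    rcases k2_mem_word p0 q p2 L1 L2 l hl with rfl | rfl | hl'
    · exact absurd (hL1.2.symm.trans hj) (by decide)
    · exact absurd (hL2.2.symm.trans hj) (by decide)
    · exact ⟨ht l hl', hl'⟩
  -- kill every variable x₂ letter
  have killed : ∀ l ∈ w, l.1 = 1 → l.2.1 = 2 → ∀ v, l.2.2.2 = some v → l.2.2.1 = 0 := by
    intro l hl hi hj v hv
    obtain ⟨A, B, hAB⟩ := List.append_of_mem hl
    have hnn : ∀ (A : List _) (l : Fin 3 × Fin 3 × ℝ × Option σ) (B : List _), w = A ++ l :: B →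
        l.2.2.2 = some v →
        0 ≤ (P2 * (A.map (fun l => (Matrix.transvection (Prod.fst l) (Prod.fst (Prod.snd l)) (Option.elim (Prod.snd (Prod.snd (Prod.snd l))) (Prod.fst (Prod.snd (Prod.snd l))) (fun _ => (0 : ℝ))) : Matrix (Fin 3) (Fin 3) ℝ))).prod : Matrix (Fin 3) (Fin 3) ℝ) 1 l.1 * l.2.2.1 *
          ((B.map (fun l => (Matrix.transvection (Prod.fst l) (Prod.fst (Prod.snd l)) (Option.elim (Prod.snd (Prod.snd (Prod.snd l))) (Prod.fst (Prod.snd (Prod.snd l))) (fun _ => (0 : ℝ))) : Matrix (Fin 3) (Fin 3) ℝ))).prod * 1 : Matrix (Fin 3) (Fin 3) ℝ) l.2.1 2 := by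
      intro A l B hAB _
      rw [Matrix.mul_one]
      have hBblk := sufblk A l B hAB
      have hlw : l ∈ w := by rw [hAB]; simp
      rcases three l.2.1 with hj | hj | hj
      · rw [hj, hBblk.1, mul_zero]
      · rw [hj, hBblk.2.1, mul_zero]
      · rw [hj, hBblk.2.2.2.2, mul_one]
        obtain ⟨htl, -⟩ := col2mem l hlw hj
        rcases three l.1 with hi | hi | hi
        · -- a far letter: tame and non-adjacent, hence zero
          have : l.2.2.1 = 0 := by
            rcases htl with ⟨-, hadj⟩ | h0
            · rw [hi, hj] at hadj; simp at hadj
            · exact h0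
          rw [this]; simp
        · rw [hi]
          have hc : 0 ≤ l.2.2.1 := by
            rcases htl with ⟨hc, -⟩ | h0
            · exact hc.le
            · exact h0.ge
          exact mul_nonneg (by linarith [pref A l B hAB]) hc
        · exact absurd (hi.trans hj.symm) (hw l hlw)
    have K := k2_kill v w P2 1 1 2 hnn
    have hsum : (P2 * (Matrix.map ((w.map (fun l => (Matrix.transvection (Prod.fst l) (Prod.fst (Prod.snd l)) (MvPolynomial.C (Prod.fst (Prod.snd (Prod.snd l))) * Option.elim (Prod.snd (Prod.snd (Prod.snd l))) 1 MvPolynomial.X) : Matrix (Fin 3) (Fin 3) (MvPolynomial σ ℝ)))).prod) (fun p => MvPolynomial.constantCoeff (MvPolynomial.pderiv v p)) : Matrix (Fin 3) (Fin 3) ℝ) * 1 : Matrix (Fin 3) (Fin 3) ℝ) 1 2 = 0 := by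
      rw [hF, k2Dm_far v F hdeg2]; simp
    have := K.2 hsum A l B hAB hv
    rw [hi, hj, Matrix.mul_one, (sufblk A l B hAB).2.2.2.2, mul_one] at this
    rcases mul_eq_zero.1 this with h | h
    · linarith [pref A l B hAB]
    · exact h
  -- hence every letter feeding column 2 has zero coefficient, so F = 0
  refine hF0 (k2_close_col2 F w (fun l hl hj => ?_) hF)
  obtain ⟨htl, hl'⟩ := col2mem l hl hj
  rcases three l.1 with hi | hi | hi
  · rcases htl with ⟨-, hadj⟩ | h0
    · rw [hi, hj] at hadj; simp at hadj
    · exact h0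
  · rcases ho : l.2.2.2 with _ | v
    · exact (conf l hl' ho).1 hi hj
    · exact killed l hl hi hj v ho
  · exact absurd (hi.trans hj.symm) (hw l hl)

end Summit.ValiantsHypothesis.ValiantsHypothesis.Cruxes.WordLengthQP.PositiveMonoidExits

end
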